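/-
Copyright (c) 2026 the pub-hodgecm-mathlib formalisation cell (harness21).  Prover seat hodgecm-mathlib-K2E5-p16 (g4): Track B «K2-LIT»,
hLiu418 = stmt-HodgeConjecture-24832, ROAD Φ organ Φ6b-1⁺ (self-offered on the K2 bus 2026-09-04T06:4xZ under LEAD F0P6-plan (g12) ∕ co-dealer
K2E5-plan (g5)): the `det(g)`-SCALING LAW of the `ξ`-majorant and the resulting bound for Shimura's `ξ` uniform in `h`; 2026-09-04.
-/
import Summits.HodgeConjecture.HodgeConjecture.Theorems.K2LiuHermTwoConfluentXiConvergence  -- ★ (this seat): `integrable_xiTwoIntegrand`, `norm_xiTwo_le`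
import Summits.HodgeConjecture.HodgeConjecture.Theorems.K2LiuHermTwoGammaSiegelGindikin    -- ★ (this seat): `det_eq_ofReal_of_posDef`
import HarnessLib

/-!
# Crux `HLiu418`, ROAD Φ, organ Φ6b-1⁺: the scaling law `∫_{Herm₂(ℂ)} |det(g + ix)|^{−σ} dx = C(σ) · det(g)^{2−σ}` (`σ > 3`)
# and the bound `‖ξ(g, h; α, β)‖ ≤ e^{2π(|im α| + |im β|)} · C(re(α+β)) · det(g)^{2−re(α+β)}` uniform in `h`

Cell `hodgecm-mathlib`, crux item hLiu418 = `stmt-HodgeConjecture-24832`, route of record `HCCMUnconditional`; squad K2, LEAD F0P6-plan (g12), co-dealer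
K2E5-plan (g5) (CENSUS-41 row Φ6: «bound `≤ C(s)·(poly in β, y)·…` locally uniform in `s`»), prover K2E5-p16 (g4).  THEOREMS ONLY (no `def`, no
instance, no notation, no named-fact hypothesis, no `sorry`, default heartbeats); lane `--supports stmt-HodgeConjecture-24832 --as helper`.

WHAT IS PROVED.  With the (finite, unevaluated) constants `C₁(σ) = ∫_ℝ (1+t²)^{−σ/2} dt`, `C₂(σ) = ∫_ℂ (1+‖u‖²)^{1−σ} du`,
`C₃(σ) = ∫_ℝ (1+t²)^{1−σ/2} dt` and `C(σ) = C₁C₂C₃`: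
* `integral_sq_add_const_rpow` — `∫_ℝ (a²+p²)^{1−σ/2} da = p^{3−σ} C₃(σ)` (scaling);
* `integral_norm_det_rpow_neg_hermTwo` ∕ `integral_norm_det_add_I_smul_rpow_neg` — THE SCALING LAW
  `∫ |det(g + ix)|^{−σ} dx = C(σ) · det(g)^{2−σ}` for `g > 0`, `σ > 3` (chart and matrix forms; `det g` is the positive real
  ★ `det_eq_ofReal_of_posDef`) — Shimura's homogeneity `det(g)^{κ−α−β}` at `h = 0` in absolute value, κ = 2;
* `norm_xiTwo_le_det_rpow` — `‖ξ(g, h; α, β)‖ ≤ e^{2π(|im α| + |im β|)} · C(re(α+β)) · det(g)^{2−re(α+β)}` for `h` Hermitian, `re(α+β) > 3`: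
  the `g`- and `h`-dependence of the absolute bound is EXPLICIT (polynomial decay in `det g`, uniform in `h`).
PROOF.  ★ `integrable_kernel` ∕ ★ `integral_kernel_fibre_zb` (Fubini b → z, value `M·(a²+p²)^{1−σ/2}`, `M = C₁C₂(det g/p)^{1−σ}(det g/p²)`), then
the `a`-integral by scaling; the powers of `p` cancel: `(det g/p)^{1−σ}(det g/p²)·p^{3−σ} = det(g)^{2−σ}`.
HONEST LABEL.  Count-neutral helper of the K2_Liu road; it pays no socket by itself: `HC_CM` is proved only modulo the 7 printed citations
(2 remaining named inputs: hLiu418 = `stmt-HodgeConjecture-24832`, h413 = `stmt-HodgeConjecture-24833`) until rung 0 closes.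
References (orientation only): [Shimura1982] §1 (1.26)–(1.31).
-/

set_option autoImplicit false
-- the mandated namespace repeats the single-problem summit's segment (`HodgeConjecture.HodgeConjecture`)
set_option linter.dupNamespace false

noncomputable section

open Complex MeasureTheory Set
open scoped ComplexOrder ComplexConjugate

namespace Summit.HodgeConjecture.HodgeConjecture.Cruxes.HLiu418.K2LiuHermTwoDetPowerScaling

open Summit.HodgeConjecture.HodgeConjecture.Cruxes.HLiu418.K2LiuHermTwoGammaDefs
open Summit.HodgeConjecture.HodgeConjecture.Cruxes.HLiu418.K2LiuHermTwoDetPowerFibres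
open Summit.HodgeConjecture.HodgeConjecture.Cruxes.HLiu418.K2LiuHermTwoDetPowerIntegrable
open Summit.HodgeConjecture.HodgeConjecture.Cruxes.HLiu418.K2LiuHermTwoConfluentXiDefs
open Summit.HodgeConjecture.HodgeConjecture.Cruxes.HLiu418.K2LiuHermTwoConfluentXiConvergence
open Summit.HodgeConjecture.HodgeConjecture.Cruxes.HLiu418.K2LiuHermTwoGammaSiegelGindikin

/-! ## The `a`-integral by scaling -/

/-- `∫_ℝ (a² + p²)^{1−σ/2} da = p^{3−σ} · ∫_ℝ (1 + t²)^{1−σ/2} dt` (`p > 0`; scaling `a = p t`). -/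
theorem integral_sq_add_const_rpow {p : ℝ} (hp : 0 < p) (σ : ℝ) :
    ∫ a : ℝ, (a ^ 2 + p ^ 2) ^ (1 - σ / 2) = p ^ (3 - σ) * ∫ t : ℝ, (1 + t ^ 2) ^ (1 - σ / 2) := by
  have h2 := Measure.integral_comp_mul_left (fun a : ℝ => (a ^ 2 + p ^ 2) ^ (1 - σ / 2)) p
  have h3 : (fun t : ℝ => (fun a : ℝ => (a ^ 2 + p ^ 2) ^ (1 - σ / 2)) (p * t)) =
      fun t => (p ^ 2) ^ (1 - σ / 2) * (1 + t ^ 2) ^ (1 - σ / 2) := by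
    funext t
    simp only []
    rw [show (p * t) ^ 2 + p ^ 2 = p ^ 2 * (1 + t ^ 2) by ring, Real.mul_rpow (by positivity) (by positivity)]
  rw [h3, integral_const_mul, abs_of_pos (inv_pos.mpr hp), smul_eq_mul] at h2
  have hp0 : p ≠ 0 := hp.ne'
  have hpow : p * (p ^ 2) ^ (1 - σ / 2) = p ^ (3 - σ) := by
    rw [show (p ^ 2 : ℝ) = p ^ (2 : ℝ) by norm_cast, ← Real.rpow_mul hp.le,
      show p * p ^ ((2 : ℝ) * (1 - σ / 2)) = p ^ (1 : ℝ) * p ^ ((2 : ℝ) * (1 - σ / 2)) by rw [Real.rpow_one],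
      ← Real.rpow_add hp]
    congr 1
    ring
  calc ∫ a : ℝ, (a ^ 2 + p ^ 2) ^ (1 - σ / 2)
        = p * ((p ^ 2) ^ (1 - σ / 2) * ∫ t : ℝ, (1 + t ^ 2) ^ (1 - σ / 2)) := by
          rw [h2]
          field_simp
    _ = p ^ (3 - σ) * ∫ t : ℝ, (1 + t ^ 2) ^ (1 - σ / 2) := by rw [← mul_assoc, hpow]

/-! ## The scaling law -/

/-- THE SCALING LAW, chart form: for `g = hermTwo (p, w, q)` (`0 < p`, `|w|² < pq`) and `σ > 3`,
`∫ |det(g + ix)|^{−σ} dx = C₁(σ) C₂(σ) C₃(σ) · (pq − |w|²)^{2−σ}`. -/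
theorem integral_norm_det_rpow_neg_hermTwo (d : ℝ × ℂ × ℝ) (hd : 0 < d.1 ∧ normSq d.2.1 < d.1 * d.2.2) {σ : ℝ} (hσ : 3 < σ) :
    ∫ c : ℝ × ℂ × ℝ, ‖(hermTwo d + I • hermTwo c).det‖ ^ (-σ) =
      ((∫ t : ℝ, (1 + t ^ 2) ^ (-σ / 2)) * (∫ u : ℂ, (1 + ‖u‖ ^ 2) ^ (1 - σ)) * (∫ t : ℝ, (1 + t ^ 2) ^ (1 - σ / 2))) *
        (d.1 * d.2.2 - normSq d.2.1) ^ (2 - σ) := by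
  obtain ⟨p, w, q⟩ := d
  have hp : 0 < p := hd.1
  have hpq : normSq w < p * q := hd.2
  have hδ : 0 < p * q - normSq w := by linarith
  -- the kernel in the chart (★ Φ6b-1 variables instantiated by `rfl`)
  have hint := integrable_kernel (p := p) (q := q) (w := w) (σ := σ)
    (fun a z => (p * ‖z - ((a / p : ℝ) : ℂ) * w‖ ^ 2 + (a ^ 2 + p ^ 2) * (p * q - normSq w) / p) / (a ^ 2 + p ^ 2))
    (fun _ _ => rfl)
    (fun a z => (p * (q * a - 2 * (w * conj z).re) - a * (p * q - normSq w + normSq z)) / (a ^ 2 + p ^ 2))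
    (fun _ _ => rfl)
    (fun c => ((c.1 ^ 2 + p ^ 2) *
      ((c.2.2 + (p * (q * c.1 - 2 * (w * conj c.2.1).re) - c.1 * (p * q - normSq w + normSq c.2.1)) / (c.1 ^ 2 + p ^ 2)) ^ 2 +
        ((p * ‖c.2.1 - ((c.1 / p : ℝ) : ℂ) * w‖ ^ 2 + (c.1 ^ 2 + p ^ 2) * (p * q - normSq w) / p) / (c.1 ^ 2 + p ^ 2)) ^ 2)) ^
          (-σ / 2))
    (fun _ => rfl) hp hpq hσ
  have hval := fun a : ℝ => integral_kernel_fibre_zb (p := p) (q := q) (w := w) (σ := σ)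
    (fun a z => (p * ‖z - ((a / p : ℝ) : ℂ) * w‖ ^ 2 + (a ^ 2 + p ^ 2) * (p * q - normSq w) / p) / (a ^ 2 + p ^ 2))
    (fun _ _ => rfl)
    (fun a z => (p * (q * a - 2 * (w * conj z).re) - a * (p * q - normSq w + normSq z)) / (a ^ 2 + p ^ 2))
    (fun _ _ => rfl)
    (fun c => ((c.1 ^ 2 + p ^ 2) *
      ((c.2.2 + (p * (q * c.1 - 2 * (w * conj c.2.1).re) - c.1 * (p * q - normSq w + normSq c.2.1)) / (c.1 ^ 2 + p ^ 2)) ^ 2 +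
        ((p * ‖c.2.1 - ((c.1 / p : ℝ) : ℂ) * w‖ ^ 2 + (c.1 ^ 2 + p ^ 2) * (p * q - normSq w) / p) / (c.1 ^ 2 + p ^ 2)) ^ 2)) ^
          (-σ / 2))
    (fun _ => rfl) hp hpq (by linarith) a
  -- rewrite the integrand as the kernel
  have hcongr : (fun c : ℝ × ℂ × ℝ => ‖(hermTwo (p, w, q) + I • hermTwo c).det‖ ^ (-σ)) = fun c => ((c.1 ^ 2 + p ^ 2) *
      ((c.2.2 + (p * (q * c.1 - 2 * (w * conj c.2.1).re) - c.1 * (p * q - normSq w + normSq c.2.1)) / (c.1 ^ 2 + p ^ 2)) ^ 2 +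
        ((p * ‖c.2.1 - ((c.1 / p : ℝ) : ℂ) * w‖ ^ 2 + (c.1 ^ 2 + p ^ 2) * (p * q - normSq w) / p) / (c.1 ^ 2 + p ^ 2)) ^ 2)) ^
          (-σ / 2) := by
    funext c
    obtain ⟨a, z, b⟩ := c
    exact norm_det_rpow_neg_eq hp σ a z b
  rw [hcongr, Measure.volume_eq_prod, integral_prod _ hint]
  rw [show (fun a : ℝ => ∫ zb : ℂ × ℝ, (fun c : ℝ × ℂ × ℝ => ((c.1 ^ 2 + p ^ 2) *
      ((c.2.2 + (p * (q * c.1 - 2 * (w * conj c.2.1).re) - c.1 * (p * q - normSq w + normSq c.2.1)) / (c.1 ^ 2 + p ^ 2)) ^ 2 +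
        ((p * ‖c.2.1 - ((c.1 / p : ℝ) : ℂ) * w‖ ^ 2 + (c.1 ^ 2 + p ^ 2) * (p * q - normSq w) / p) / (c.1 ^ 2 + p ^ 2)) ^ 2)) ^
          (-σ / 2)) (a, zb)) = fun a =>
      ((∫ t : ℝ, (1 + t ^ 2) ^ (-σ / 2)) * (∫ u : ℂ, (1 + ‖u‖ ^ 2) ^ (1 - σ)) *
          ((p * q - normSq w) / p) ^ (1 - σ) * ((p * q - normSq w) / p ^ 2)) * (a ^ 2 + p ^ 2) ^ (1 - σ / 2) from funext hval,
    integral_const_mul, integral_sq_add_const_rpow hp σ]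
  -- the powers of `p` cancel
  simp only []
  have hp0 : p ≠ 0 := hp.ne'
  have h1 : ((p * q - normSq w) / p) ^ (1 - σ) = (p * q - normSq w) ^ (1 - σ) * p ^ (σ - 1) := by
    rw [Real.div_rpow hδ.le hp.le, div_eq_mul_inv, ← Real.rpow_neg hp.le, neg_sub]
  have h2 : (p * q - normSq w) ^ (1 - σ) * (p * q - normSq w) = (p * q - normSq w) ^ (2 - σ) := by
    conv_lhs => rw [show (p * q - normSq w) ^ (1 - σ) * (p * q - normSq w) =
      (p * q - normSq w) ^ (1 - σ) * (p * q - normSq w) ^ (1 : ℝ) by rw [Real.rpow_one], ← Real.rpow_add hδ]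
    congr 1
    ring
  have h3 : p ^ (σ - 1) * p ^ (3 - σ) = p ^ 2 := by
    rw [← Real.rpow_add hp, show σ - 1 + (3 - σ) = (2 : ℝ) by ring]
    norm_cast
  calc (∫ t : ℝ, (1 + t ^ 2) ^ (-σ / 2)) * (∫ u : ℂ, (1 + ‖u‖ ^ 2) ^ (1 - σ)) *
          ((p * q - normSq w) / p) ^ (1 - σ) * ((p * q - normSq w) / p ^ 2) *
        (p ^ (3 - σ) * ∫ t : ℝ, (1 + t ^ 2) ^ (1 - σ / 2))
      = ((∫ t : ℝ, (1 + t ^ 2) ^ (-σ / 2)) * (∫ u : ℂ, (1 + ‖u‖ ^ 2) ^ (1 - σ)) * (∫ t : ℝ, (1 + t ^ 2) ^ (1 - σ / 2))) *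
          (((p * q - normSq w) ^ (1 - σ) * (p * q - normSq w)) * ((p ^ (σ - 1) * p ^ (3 - σ)) / p ^ 2)) := by
          rw [h1]
          field_simp
    _ = _ := by rw [h2, h3, div_self (by positivity), mul_one]

/-- THE SCALING LAW: for `g` positive definite (`2 × 2` complex Hermitian) and `σ > 3`,
`∫_{Herm₂(ℂ)} |det(g + ix)|^{−σ} dx = C₁(σ) C₂(σ) C₃(σ) · det(g)^{2−σ}`, `det g` being the positive real `g₀₀ g₁₁ − |g₀₁|²`. -/
theorem integral_norm_det_add_I_smul_rpow_neg {g : Matrix (Fin 2) (Fin 2) ℂ} (hg : g.PosDef) {σ : ℝ} (hσ : 3 < σ) :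
    ∫ c : ℝ × ℂ × ℝ, ‖(g + I • hermTwo c).det‖ ^ (-σ) =
      ((∫ t : ℝ, (1 + t ^ 2) ^ (-σ / 2)) * (∫ u : ℂ, (1 + ‖u‖ ^ 2) ^ (1 - σ)) * (∫ t : ℝ, (1 + t ^ 2) ^ (1 - σ / 2))) *
        ((g 0 0).re * (g 1 1).re - normSq (g 0 1)) ^ (2 - σ) := by
  have hg' : hermTwo ((g 0 0).re, g 0 1, (g 1 1).re) = g := hermTwo_eq_of_isHermitian hg.1
  have hd := (posDef_hermTwo_iff ((g 0 0).re, g 0 1, (g 1 1).re)).mp (hg'.symm ▸ hg)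
  conv_lhs => rw [← hg']
  exact integral_norm_det_rpow_neg_hermTwo _ hd hσ

/-! ## The bound for `ξ`, explicit in `g` and uniform in `h` -/

/-- **THE ABSOLUTE BOUND FOR SHIMURA'S `ξ`, explicit in `g` and uniform in `h`**: for `g` positive definite, `h` Hermitian and `re(α+β) > 3`,
`‖ξ(g, h; α, β)‖ ≤ e^{2π(|im α| + |im β|)} · C₁C₂C₃(re(α+β)) · det(g)^{2 − re(α+β)}`. -/
theorem norm_xiTwo_le_det_rpow {g h : Matrix (Fin 2) (Fin 2) ℂ} (hg : g.PosDef) (hh : h.IsHermitian) {α β : ℂ}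
    (hαβ : 3 < (α + β).re) :
    ‖xiTwo g h α β‖ ≤ Real.exp (2 * Real.pi * (|α.im| + |β.im|)) *
      (((∫ t : ℝ, (1 + t ^ 2) ^ (-(α + β).re / 2)) * (∫ u : ℂ, (1 + ‖u‖ ^ 2) ^ (1 - (α + β).re)) *
          (∫ t : ℝ, (1 + t ^ 2) ^ (1 - (α + β).re / 2))) *
        ((g 0 0).re * (g 1 1).re - normSq (g 0 1)) ^ (2 - (α + β).re)) := by
  have h := norm_xiTwo_le hg hh hαβ
  rw [integral_norm_det_add_I_smul_rpow_neg hg hαβ] at h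
  exact h

end Summit.HodgeConjecture.HodgeConjecture.Cruxes.HLiu418.K2LiuHermTwoDetPowerScaling

end
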